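import Summits.ResolutionOfSingularities.ResolutionOfSingularities.Theorems.FrobeniusLadderFInjectiveMacaulayficationDesingularizationOffClosedPointsAdm
import Summits.ResolutionOfSingularities.ResolutionOfSingularities.Theorems.FrobeniusLadderFInjectiveMacaulayficationRegularOffFiniteOfLRFibre
import Summits.ResolutionOfSingularities.ResolutionOfSingularities.Theorems.FrobeniusLadderFInjectiveMacaulayficationLocalBlowupDesingularizationDimThree
import Summits.ResolutionOfSingularities.ResolutionOfSingularities.Theorems.FrobeniusLadderFInjectiveMacaulayficationTerminationModClosedPoints
import HarnessLib

/-!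
# (LR_adm) `LocalResolutionNonClosedGe4Adm` — the «LD» door's local-resolution stub in TEMKIN'S (iii) CATEGORY: X_reg-ADMISSIBLE, fibre-singular local
# blow-ups at non-closed points of local dimension ≥ 4 — and REGULAR OFF FINITELY MANY CLOSED POINTS modulo (LR_adm) + the threefold package
# (crux `FInjectiveMacaulayfication` stmt-ResolutionOfSingularities-15315, chain w45a; res-L1-w45a-plan-1 RULING R17.8 programme «AD» (AD2-2); seat
# res-L1-w45a-stub-3 g7)

[OURS · L1 W4.5a] Support file (`--supports stmt-ResolutionOfSingularities-15315 --as helper`); replaces the role of NO printed item; NOT a statement of any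
manuscript; ONE definition (`@[conjecture] def`, OURS candidate, consumed only as a hypothesis; no instance, no notation, no named fact) and its consumers,
CONDITIONAL on {CP 2019 Thm. 1.1 (i)(ii), Raynaud–Gruson 5.2.2, CP 2019 Prop. 4.4} BY NAME. AI-written (AI review is weaker than expert review). Twin of
`…RegularOffFiniteOfLRFibre` ((LR♭), p588580): the single insertion of the ADMISSIBILITY clause `Supp I ⊆ (Reg Spec 𝒪_{X,x})ᶜ` after `IsBlowup g I`;
(LR♭) ⇒ (LR_adm) (`localResolutionNonClosedGe4Adm_of_fibre`), so (LR_adm) is the weaker-or-equal registered residue (door v36.2, R17.8 (AD4)).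

* `LocalResolutionNonClosedGe4Adm` — (LR_adm) = [Temkin 2008, Prop. 2.3.4 (iii)] verbatim category, sliced to non-closed points of local dimension ≥ 4.
* `hlocAdm_of_cp_of_LRadm` — the disjunctive hypothesis of `DesingularizationOffClosedPointsAdm.desingularization_offClosedPoints_of_local_adm` from CP +
  (LR_adm); **`regularOffFinite_of_LRadm (hG h081R hP) (hLR_adm) … (h3 : 3 ≤ topologicalKrullDim X)`** — regular off finitely many closed points.
[cite: Temkin2008, Prop. 2.3.4 (iii); Def. 2.2.6] [cite: CossartPiltant2019, Thm. 1.1 (i)(ii); Prop. 4.4] [cite: GortzWedhorn2020, Thm. 5.22]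
-/

-- single-problem summit: the doubled namespace component is forced
set_option linter.dupNamespace false

noncomputable section

namespace Summit.ResolutionOfSingularities.ResolutionOfSingularities.Theorems.FInjectiveMacaulayfication.RegularOffFiniteOfLRAdm

open CategoryTheory CategoryTheory.Limits AlgebraicGeometry TopologicalSpace IsLocalRing
open Literature.AlgebraicGeometry.Resolution
open Summit.ResolutionOfSingularities.ResolutionOfSingularities.Theorems.FInjectiveMacaulayfication

/-! ## §1 The candidate (LR_adm) and its comparison with (LR♭) -/

/-- [OURS · candidate statement, the «LD» door's LOCAL RESOLUTION stub, Temkin (iii) category] **(LR_adm) `LocalResolutionNonClosedGe4Adm`**: for every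
prime `p`, field `k` of characteristic `p`, INTEGRAL separated finite-type `k`-scheme `X` and NON-CLOSED point `x ∈ X` with `4 ≤ dim 𝒪_{X,x}`, every
ADMISSIBLE blowing up `g : S′ → Spec 𝒪_{X,x}` (along `I` with `Supp I ⊆ (Reg Spec 𝒪_{X,x})ᶜ`) WHOSE SINGULAR POINTS ALL LIE IN THE CLOSED FIBRE admits a
desingularization. [candidate statement, OURS; open] [cite: Temkin2008, Prop. 2.3.4 (iii); Def. 2.2.6] -/
@[conjecture] def LocalResolutionNonClosedGe4Adm : Prop :=
  ∀ (p : ℕ), p.Prime → ∀ (k : Type) [Field k] [CharP k p]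
    (X : Scheme.{0}) (f : X ⟶ Spec (.of k)),
      IsSeparated f → LocallyOfFiniteType f → QuasiCompact f → IsIntegral X →
      ∀ x : X, ¬ IsClosed ({x} : Set X) → (4 : WithBot ℕ∞) ≤ ringKrullDim (X.presheaf.stalk x) →
      ∀ (S' : Scheme.{0}) (g : S' ⟶ Spec (X.presheaf.stalk x)) (I : (Spec (X.presheaf.stalk x)).IdealSheafData),
        IsBlowup g I → ((I.support : Set _) ⊆ (Scheme.regularLocus (Spec (X.presheaf.stalk x)))ᶜ) →
        (∀ s : S', s ∉ Scheme.regularLocus S' → g.base s = closedPoint (X.presheaf.stalk x)) →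
        Scheme.AdmitsDesingularization S'

/-- **(LR♭) ⇒ (LR_adm)**: forget the admissibility clause. [plumbing] -/
theorem localResolutionNonClosedGe4Adm_of_fibre (h : RegularOffFiniteOfLRFibre.LocalResolutionNonClosedGe4Fibre) :
    LocalResolutionNonClosedGe4Adm :=
  fun p hp k _ _ X f hs hl hq hi x hx h4 S' g I hg _ hfib => h p hp k X f hs hl hq hi x hx h4 S' g I hg hfib

/-! ## §2 The hypothesis of THEOREM A-adm from CP + (LR_adm) -/

/-- **(hloc) of `desingularization_offClosedPoints_of_local_adm` from Cossart–Piltant below local dimension 4 and (LR_adm) at local dimension ≥ 4**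
(`X` integral of finite type over `k`, `dim X ≥ 3`). [OURS · conditional-result] [cite: CossartPiltant2019, Thm. 1.1 (i)(ii); Prop. 4.4]
[cite: GortzWedhorn2020, Thm. 5.22] -/
theorem hlocAdm_of_cp_of_LRadm
    (hG : CossartPiltant2019General.{0}) (h081R : Stacks081R.{0}) (hP : CossartPiltant2019Principalization.{0})
    (hLR : LocalResolutionNonClosedGe4Adm)
    (p : ℕ) (hp : p.Prime) (k : Type) [Field k] [CharP k p] (X : Scheme.{0}) (f₀ : X ⟶ Spec (.of k))
    [IsSeparated f₀] [LocallyOfFiniteType f₀] [QuasiCompact f₀] [IsIntegral X] (h3 : (3 : WithBot ℕ∞) ≤ topologicalKrullDim X) :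
    ∀ ζ : X, ¬ IsClosed ({ζ} : Set X) →
      (∀ (S' : Scheme.{0}) (g : S' ⟶ Spec (X.presheaf.stalk ζ)) (I : (Spec (X.presheaf.stalk ζ)).IdealSheafData),
        IsBlowup g I → ((I.support : Set _) ⊆ (Scheme.regularLocus (Spec (X.presheaf.stalk ζ)))ᶜ) →
          (∀ s : S', s ∉ Scheme.regularLocus S' → g.base s = closedPoint (X.presheaf.stalk ζ)) →
          Scheme.AdmitsDesingularization S') ∨
      (∃ x : X, ζ ⤳ x ∧ ∀ (S' : Scheme.{0}) (g : S' ⟶ Spec (X.presheaf.stalk x)) (I : (Spec (X.presheaf.stalk x)).IdealSheafData),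
        IsBlowup g I → ((I.support : Set _) ⊆ (Scheme.regularLocus (Spec (X.presheaf.stalk x)))ᶜ) →
          Scheme.AdmitsDesingularization S') := by
  intro ζ hζ
  haveI : IsLocallyNoetherian X := LocallyOfFiniteType.isLocallyNoetherian f₀
  haveI : CompactSpace X := QuasiCompact.compactSpace_of_compactSpace f₀
  obtain ⟨d₀, hd₀⟩ := exists_topologicalKrullDim_le_of_locallyOfFiniteType f₀
  obtain ⟨d, hd⟩ := exists_topologicalKrullDim_eq_nat hd₀
  have h3d : 3 ≤ d := by
    rw [hd] at h3
    exact_mod_cast h3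
  obtain ⟨n, hn⟩ := exists_nat_cast_eq_ringKrullDim (R := X.presheaf.stalk ζ)
  by_cases hn3 : n ≤ 3
  · -- below local dimension 4: specialise to a loc-dim-3 point, Cossart–Piltant there (no fibre condition needed)
    obtain ⟨x, hζx, hx3⟩ := RegularOffCodimFourResidue.exists_specializes_ringKrullDim_stalk_eq f₀ hd ζ (n := 3)
      (by rw [hn]; exact_mod_cast hn3) h3d
    exact Or.inr ⟨x, hζx, fun S' g I hg _ => LocalBlowupDesingularizationDimThree.localBlowups_hloc hG h081R hP f₀ x hx3 S' g I hg⟩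
  · -- local dimension ≥ 4: (LR_adm) at `ζ` itself
    refine Or.inl (hLR p hp k X f₀ inferInstance inferInstance inferInstance inferInstance ζ hζ ?_)
    rw [hn]
    exact_mod_cast (by omega : 4 ≤ n)

/-! ## §3 Regular off finitely many closed points, every dimension ≥ 3, modulo (LR_adm) -/

/-- **REGULAR OFF FINITELY MANY CLOSED POINTS in every dimension ≥ 3, modulo (LR_adm) and the threefold package**: for `X` integral separated of
finite type over `k` with `dim X ≥ 3` there are a blowing up `f : X′ → X` along `J` with `Supp J ⊆ (Reg X)ᶜ` and a closed FINITE set `F` of CLOSED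
points with `X′` regular at every point not over `F`. [OURS · conditional-result] [cite: Temkin2008, Prop. 2.3.4] [cite: CossartPiltant2019, Thm. 1.1 (i)(ii); Prop. 4.4] -/
theorem regularOffFinite_of_LRadm
    (hG : CossartPiltant2019General.{0}) (h081R : Stacks081R.{0}) (hP : CossartPiltant2019Principalization.{0})
    (hLR : LocalResolutionNonClosedGe4Adm)
    (p : ℕ) (hp : p.Prime) (k : Type) [Field k] [CharP k p] (X : Scheme.{0}) (f₀ : X ⟶ Spec (.of k))
    [IsSeparated f₀] [LocallyOfFiniteType f₀] [QuasiCompact f₀] [IsIntegral X] (h3 : (3 : WithBot ℕ∞) ≤ topologicalKrullDim X) :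
    ∃ (X' : Scheme.{0}) (f : X' ⟶ X) (J : X.IdealSheafData) (F : Set X), IsBlowup f J ∧
      (J.support : Set X) ⊆ (Scheme.regularLocus X)ᶜ ∧ IsClosed F ∧ F.Finite ∧ (∀ b ∈ F, IsClosed ({b} : Set X)) ∧
      ∀ x' : X', f x' ∉ F → x' ∈ Scheme.regularLocus X' := by
  have hk : Scheme.IsQuasiExcellent (Spec (.of k)) :=
    Scheme.isQuasiExcellent_of_locallyOfFiniteType Stacks07QW_field_holds (𝟙 (Spec (.of k)))
  haveI : IsNoetherianRing (CommRingCat.of k) := inferInstanceAs (IsNoetherianRing k)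
  exact DesingularizationOffClosedPointsAdm.desingularization_offFinite_of_local_adm hk f₀
    (hlocAdm_of_cp_of_LRadm hG h081R hP hLR p hp k X f₀ h3)

/-- The same with `J ≠ ⊥` recorded (the generic point is regular, hence off `Supp J`). [OURS · conditional-result] [cite: Temkin2008, Prop. 2.3.4] -/
theorem regularOffFinite_of_LRadm'
    (hG : CossartPiltant2019General.{0}) (h081R : Stacks081R.{0}) (hP : CossartPiltant2019Principalization.{0})
    (hLR : LocalResolutionNonClosedGe4Adm)
    (p : ℕ) (hp : p.Prime) (k : Type) [Field k] [CharP k p] (X : Scheme.{0}) (f₀ : X ⟶ Spec (.of k))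
    [IsSeparated f₀] [LocallyOfFiniteType f₀] [QuasiCompact f₀] [IsIntegral X] (h3 : (3 : WithBot ℕ∞) ≤ topologicalKrullDim X) :
    ∃ (X' : Scheme.{0}) (f : X' ⟶ X) (J : X.IdealSheafData) (F : Set X), IsBlowup f J ∧ J ≠ ⊥ ∧
      (J.support : Set X) ⊆ (Scheme.regularLocus X)ᶜ ∧ IsClosed F ∧ F.Finite ∧ (∀ b ∈ F, IsClosed ({b} : Set X)) ∧
      ∀ x' : X', f x' ∉ F → x' ∈ Scheme.regularLocus X' := by
  obtain ⟨X', f, J, F, hf, hJ, hFc, hF, hFcl, hreg⟩ := regularOffFinite_of_LRadm hG h081R hP hLR p hp k X f₀ h3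
  refine ⟨X', f, J, F, hf, fun h0 => ?_, hJ, hFc, hF, hFcl, hreg⟩
  have hgen : genericPoint X ∈ (J.support : Set X) := by rw [h0, Scheme.IdealSheafData.support_bot]; trivial
  have := hJ hgen
  rw [Set.mem_compl_iff, Scheme.mem_regularLocus] at this
  exact this (inferInstanceAs (IsRegularLocalRing X.functionField))

end Summit.ResolutionOfSingularities.ResolutionOfSingularities.Theorems.FInjectiveMacaulayfication.RegularOffFiniteOfLRAdm

end
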